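import Literature.NumberTheory.Automorphic.OrdinaryPartOfCompleteModule
import Mathlib.RingTheory.AdicCompletion.AsTensorProduct
import Mathlib.RingTheory.AdicCompletion.Noetherian
import HarnessLib

/-!
# The ordinary part of a finitely generated module over a complete Noetherian ring

Topic `NumberTheory/Automorphic`; namespace `Literature.NumberTheory.Automorphic`; theorems only.
The hypotheses of `OrdinaryPartOfCompleteModule` (adic completeness, finite truncations) in the
form Hida theory meets them ([Hida1994AIF, §2–3]: `M = H^q(Y, L(n, v; 𝒪))` finitely generated over
the `p`-adically complete `𝒪`; [KhareThorne2017, §6.4]): over an `I`-adically complete Noetherian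
ring `R` with `I` in the Jacobson radical and FINITE `R ⧸ Iⁿ`, every finitely generated module `M`
is `I`-adically complete (`isPrecomplete_of_moduleFinite` — any precomplete `R`;
`isAdicComplete_of_moduleFinite`) with finite truncations (`finite_quotient_pow_smul_top`), so that
for every endomorphism `U` the conclusions of `OrdinaryPartOfCompleteModule` apply
(`isAdicComplete_and_finite_of_moduleFinite` supplies its two instance hypotheses): `U` is
bijective on `M^{ord} = ⋂ₖ range Uᵏ`, `M = M^{nil} ⊕ M^{ord}`, `M^{ord} ↠ (M ⧸ IⁿM)^{ord}`.

## References

* H. Hida, Ann. Inst. Fourier 44 (1994), §2 (held). [Hida1994AIF]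
* C. Khare, J. A. Thorne, Amer. J. Math. 139 (2017), §2.4, §6.4 (arXiv:1409.7007, held). [KhareThorne2017]
-/

namespace Literature.NumberTheory.Automorphic

open Submodule TensorProduct

variable {R M : Type*} [CommRing R] [AddCommGroup M] [Module R M] (I : Ideal R)

/-- **A finitely generated module over an `I`-adically precomplete ring is `I`-adically precomplete.**
[folklore] -/
theorem isPrecomplete_of_moduleFinite [IsPrecomplete I R] [Module.Finite R M] : IsPrecomplete I M := by
  refine AdicCompletion.of_surjective_iff.1 fun y => ?_
  obtain ⟨t, rfl⟩ := AdicCompletion.ofTensorProduct_surjective_of_finite I M y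
  have key : ∀ t : AdicCompletion I R ⊗[R] M, ∃ m : M, t = (1 : AdicCompletion I R) ⊗ₜ[R] m := by
    intro t
    induction t using TensorProduct.induction_on with
    | zero => exact ⟨0, by rw [TensorProduct.tmul_zero]⟩
    | tmul r m =>
      obtain ⟨r₀, rfl⟩ := AdicCompletion.of_surjective I R r
      refine ⟨r₀ • m, ?_⟩
      rw [← TensorProduct.smul_tmul]
      congr 1
      rw [← Algebra.algebraMap_eq_smul_one]
      rfl
    | add t₁ t₂ h₁ h₂ =>
      obtain ⟨m₁, rfl⟩ := h₁
      obtain ⟨m₂, rfl⟩ := h₂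
      exact ⟨m₁ + m₂, by rw [TensorProduct.tmul_add]⟩
  obtain ⟨m, rfl⟩ := key t
  exact ⟨m, by rw [AdicCompletion.ofTensorProduct_tmul, one_smul]⟩

/-- **A finitely generated module over an `I`-adically complete Noetherian ring with `I ≤ J(R)` is
`I`-adically complete.** [folklore] -/
theorem isAdicComplete_of_moduleFinite [IsNoetherianRing R] [IsAdicComplete I R] (hI : I ≤ Ideal.jacobson ⊥)
    [Module.Finite R M] : IsAdicComplete I M :=
  { toIsHausdorff := IsHausdorff.of_le_jacobson I M hI
    toIsPrecomplete := isPrecomplete_of_moduleFinite I }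

/-- Finite truncations: `M ⧸ IⁿM` is finite when `R ⧸ Iⁿ` is finite and `M` is finitely generated.
[folklore] -/
theorem finite_quotient_pow_smul_top [Module.Finite R M] (n : ℕ) [Finite (R ⧸ I ^ n)] :
    Finite (M ⧸ (I ^ n • ⊤ : Submodule R M)) :=
  Module.finite_of_finite (R ⧸ I ^ n)

/-- The ordinary part of a finitely generated module is finitely generated (Noetherian `R`). [folklore] -/
theorem moduleFinite_ordPart [IsNoetherianRing R] [Module.Finite R M] (φ : Module.End R M) :
    Module.Finite R (ordPart φ) :=
  Module.Finite.of_injective (ordPart φ).subtype Subtype.val_injective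

section

variable [IsNoetherianRing R] [IsAdicComplete I R] [hfin : ∀ n : ℕ, Finite (R ⧸ I ^ n)] [Module.Finite R M]

include I in
/-- **The hypotheses of `OrdinaryPartOfCompleteModule` hold for `M` finitely generated over a
complete Noetherian `R` with finite `R ⧸ Iⁿ`**: `M` is `I`-adically complete with finite
truncations — so `bijOn_ordPart`, `isCompl_nilPart_ordPart`, `mem_ordPart_iff`, `map_mkQ_ordPart`,
`ordPart_noncommProd_eq_iInf` apply (after `haveI := isAdicComplete_and_finite_of_moduleFinite …`).
[cite: Hida1994AIF, §2] [cite: KhareThorne2017, §2.4 Lemma 2.10] -/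
theorem isAdicComplete_and_finite_of_moduleFinite :
    IsAdicComplete I M ∧ ∀ n : ℕ, Finite (M ⧸ (I ^ n • ⊤ : Submodule R M)) :=
  ⟨isAdicComplete_of_moduleFinite I (IsAdicComplete.le_jacobson_bot I), fun n => finite_quotient_pow_smul_top I n⟩

/-- Usage: **`U` is bijective on `M^{ord}`** for such `M` (the other conclusions of
`OrdinaryPartOfCompleteModule` are obtained the same way). [cite: Hida1994AIF, §2] -/
example (φ : Module.End R M) : Set.BijOn φ (ordPart φ : Set M) (ordPart φ) := by
  haveI := (isAdicComplete_and_finite_of_moduleFinite (M := M) I).1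
  haveI := (isAdicComplete_and_finite_of_moduleFinite (M := M) I).2
  exact bijOn_ordPart I φ

end

end Literature.NumberTheory.Automorphic
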